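import Summits.BirchSwinnertonDyer.BirchSwinnertonDyer.Theorems.ThetaPartnerAtTwoSignedControlAtTwoSignedLocalInjSocle
import Summits.BirchSwinnertonDyer.Rank1Residual.Additive.StrictSignedSelmerInftyLocal
import Summits.BirchSwinnertonDyer.BirchSwinnertonDyer.Theorems.KatoDescentPotSupersingularFineSelmerControlTools
import Literature.NumberTheory.EllipticCurves.Sprung2012.ColemanMapLambdaActionProofs
import HarnessLib

/-!
# MOD-`p` CRITERION for Kobayashi's signed local points: if `E^ε(K_n·K_v)/p` is MONOGENIC over `ℤ[Γ_{K_v}]` then the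
# `Γ_{K_v}`-invariant classes of `E^ε(K_n·K_v)/p` inside `E(K_∞·K_v)/p` come from `E(K_v)` — step CYC ⇒ MOD-`p` of the
# reduction of INJ⁺@2 (route `ThetaPartnerAtTwo`, crux K4 `SignedControlAtTwo`, stmt-BirchSwinnertonDyer-20309, line
# `eulerchar` v4, registered stub `stub_plusLocalInjTwo`), any `K`, `p`, `κ`, `ι`, `ε`, `n`

Seat `prover-bsd-wall-tp2-p3-w3` (width seat 3/3). Sequel of `…SignedLocalInjSocle` (pure algebra: the socle of a monogenic
module over the group ring of a cyclic `p`-group, «mod `N`»).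

WHAT. `K` a field, `W/K`, `p` prime, `κ` a `ℤ_p`-extension, `E` a `K`-field with an embedding `ι : K̄ → K̄_E`, `M = E(K_∞·K_v)`
(`localTowerPointsOfEmb`), `M_n = E(K_n·K_v)`, `E^ε_n = E^ε(K_n·K_v)` (Kobayashi Def. 1.1, `signedLocalPointsOfEmb`).
* §2a `mem_localLayerPointsOfEmb_of_nsmul_mem`, `mem_signedLocalPointsOfEmb_of_nsmul_mem`, `…_of_pow_nsmul_mem` — under (NT)
  «`M` has no `p`-torsion», `M_n` and `E^ε_n` are `p`-SATURATED in `M` (Galois descent of `p`-divisibility; traces commute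
  with multiplication by `p`).
* §2b `exists_forall_smul_eq_pow_smul` — `Γ_{K_v}` acts on `M_n` through a CYCLIC group: some `g` with every `σ` acting as a
  power `g^j` (the image of `Γ_{K_v}` in `Γ_K/Gal(K̄/K_n)` is cyclic, `FineSelmerControl.exists_generator_mod_layerSubgroup`).
* §2c `modP_of_cyclic` — **MOD-`p` from CYC**: under (NT), if `E^ε_n = ℤ[Γ_{K_v}]·d + p·E^ε_n` for one `d` (CYC: Kobayashi
  Prop. 8.12 i), generation by the conjugates of the Honda point) and `E(K_v) ⊄ p·E(K_v)` (LEV0), then every `x ∈ E^ε_n` with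
  `σx − x ∈ pM` for all `σ` lies in `pM + E(K_v)`. Proof: `V = E^ε_n`, `N = pV`, `φ = g`, `D = φ − 1`; `D` is nilpotent on `d`
  modulo `N` (`g^{p^n}` fixes `M_n`; `pow_prime_pow_sub_one_apply_mem`), `V = ℤ[D]d + N` (`closure_range_pow_smul_le`), so the
  socle lemma `exists_socle_generator` gives `{v : Dv ∈ N} ⊆ ℤs + N`; the `Γ`-fixed point `m₀ ∈ E(K_v) ∖ pE(K_v)` is
  `≡ c₀ s` with `p ∤ c₀` (saturation), so the socle is the line of `m₀`; finally `x` is `D`-fixed mod `N` by saturation.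

WHY (K4). With `…PlusLocalInjOfLift` (INJ⁺@2 ⟸ LIFT⁺@2) and the sequel `…PlusLocalInjOfCyclic` (LIFT ⟸ MOD-`p` at every layer,
induction on `k`), the registered stub `stub_plusLocalInjTwo` follows from (CYC⁺@2) + (LEV0@2) alone: the `±` local theory at `2`
that K4 needs is Kobayashi's Prop. 8.12 generation statement for `E⁺(ℚ_{2,n})` read at `2` (equivalently, layerwise,
`H¹(Gal(ℚ_{2,n}/ℚ₂), E⁺(ℚ_{2,n})) = 0`; kit evidence of the lead's dossier LAGPLUS-AT-2: trivial for `n ≤ 7`).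

HONEST FRAMING: THEOREMS ONLY (no definition, no named fact, no `sorry`), route-independent (no `Theses` import); nothing about
any curve is asserted beyond the displayed hypotheses; closes no item; BSD is not proved by any of this.

References: [Kobayashi2003] S. Kobayashi, Invent. Math. 152 (2003), Def. 1.1, §2 p. 4, Prop. 8.7, Prop. 8.12 (pp. 17–18);
[BDKim2013] B. D. Kim, J. Aust. Math. Soc. 95 (2013), proof of Cor. 3.15 (p. 199); [Washington1997] §13.1;
[GreenbergLNM1716] §3 p. 87; [SerreLocalFields1979] VIII §4, IX §1.
-/

set_option autoImplicit false
-- the Theorems namespace of this sub repeats the summit name by design (D-0017 nested layout)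
set_option linter.dupNamespace false

noncomputable section

open scoped Classical

open Finset

namespace Summit.BirchSwinnertonDyer.BirchSwinnertonDyer.Theorems.SignedEC

/-! ## §2 Saturation of `E^ε(K_n·K_v)` in `E(K_∞·K_v)` and the MOD-`p` criterion -/

section ModP

open Literature.NumberTheory.EllipticCurves Literature.NumberTheory.GaloisRepresentations
  WeierstrassCurve ZpExtension Literature.NumberTheory.EllipticCurves.Kobayashi2003
  Literature.NumberTheory.EllipticCurves.Sprung2012 Summit.BirchSwinnertonDyer.Rank1Residual.Additive

universe u

variable {K : Type u} [Field K] (W : WeierstrassCurve K) {p : ℕ} [Fact p.Prime] (κ : ZpExtension K p)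
  {E : Type u} [Field E] [Algebra K E] (ι : AlgebraicClosure K →ₐ[K] AlgebraicClosure E)

/-- A Galois element commutes with multiplication by `n` on local points. [folklore] -/
theorem galois_smul_nsmul_modP (τ : Field.absoluteGaloisGroup E) (n : ℕ) (P : localPoints W E) :
    τ • (n • P) = n • (τ • P) :=
  map_nsmul (DistribSMul.toAddMonoidHom (localPoints W E) τ) n P

/-- A Galois element commutes with multiplication by an integer on local points. [folklore] -/
theorem galois_smul_zsmul_modP (τ : Field.absoluteGaloisGroup E) (n : ℤ) (P : localPoints W E) :
    τ • (n • P) = n • (τ • P) :=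
  map_zsmul (DistribSMul.toAddMonoidHom (localPoints W E) τ) n P

/-- **Descent of `p`-divisibility down the tower** (no `p`-torsion in `E(K_∞·K_v)`): a tower point `y` with
`p • y ∈ E(K_n·K_v)` lies in `E(K_n·K_v)` (for `τ ∈ Gal(K̄_v/K_n·K_v)`, `τy − y` is `p`-torsion in the tower).
[cite: Kobayashi2003, §2 p. 4 and Prop. 8.7 (p. 16)] -/
theorem mem_localLayerPointsOfEmb_of_nsmul_mem
    (hnt : ∀ P ∈ localTowerPointsOfEmb κ ι W, p • P = 0 → P = 0) (n : ℕ)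
    {y : localPoints W E} (hy : y ∈ localTowerPointsOfEmb κ ι W)
    (hpy : p • y ∈ localLayerPointsOfEmb κ ι W n) : y ∈ localLayerPointsOfEmb κ ι W n := by
  rw [mem_localLayerPointsOfEmb_iff]
  intro τ hτ
  have h1 : τ • y - y ∈ localTowerPointsOfEmb κ ι W :=
    sub_mem (smul_mem_localTowerPointsOfEmb κ ι W τ hy) hy
  have h2 : p • (τ • y - y) = 0 := by
    rw [smul_sub, ← galois_smul_nsmul_modP, (mem_localLayerPointsOfEmb_iff κ ι W n _).1 hpy τ hτ, sub_self]
  exact sub_eq_zero.1 (hnt _ h1 h2)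

/-- **`E^ε(K_n·K_v)` is `p`-saturated in `E(K_∞·K_v)`**: a tower point `y` with `p • y ∈ E^ε(K_n·K_v)` lies in
`E^ε(K_n·K_v)` — the layer by the previous lemma, each trace condition because `Tr_{n/m+1} y ∈ E(K_{m+1}·K_v)` has
`p • Tr_{n/m+1} y = Tr_{n/m+1}(p • y) ∈ E(K_m·K_v)`. [cite: Kobayashi2003, Def. 1.1 (p. 2), §2 p. 4] -/
theorem mem_signedLocalPointsOfEmb_of_nsmul_mem
    (hnt : ∀ P ∈ localTowerPointsOfEmb κ ι W, p • P = 0 → P = 0) (ε : ℤˣ) (n : ℕ)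
    {y : localPoints W E} (hy : y ∈ localTowerPointsOfEmb κ ι W)
    (hpy : p • y ∈ signedLocalPointsOfEmb κ ι W ε n) : y ∈ signedLocalPointsOfEmb κ ι W ε n := by
  rw [mem_signedLocalPointsOfEmb_iff] at hpy ⊢
  obtain ⟨hpyn, htr⟩ := hpy
  have hyn := mem_localLayerPointsOfEmb_of_nsmul_mem W κ ι hnt n hy hpyn
  refine ⟨hyn, fun m hm hε ↦ ?_⟩
  have hz : localTraceOfEmb κ ι W (m + 1) n y ∈ localLayerPointsOfEmb κ ι W (m + 1) :=
    localTraceOfEmb_mem_of_mem κ ι W (m + 1) n hyn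
  refine mem_localLayerPointsOfEmb_of_nsmul_mem W κ ι hnt m
    (localLayerPointsOfEmb_le_localTowerPointsOfEmb κ ι W (m + 1) hz) ?_
  rw [← map_nsmul]
  exact htr m hm hε

/-- Iterated saturation: `p^k • y ∈ E^ε(K_n·K_v)` with `y` a tower point forces `y ∈ E^ε(K_n·K_v)`.
[cite: Kobayashi2003, Def. 1.1 (p. 2), §2 p. 4] -/
theorem mem_signedLocalPointsOfEmb_of_pow_nsmul_mem
    (hnt : ∀ P ∈ localTowerPointsOfEmb κ ι W, p • P = 0 → P = 0) (ε : ℤˣ) (n : ℕ) {k : ℕ}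
    {y : localPoints W E} (hy : y ∈ localTowerPointsOfEmb κ ι W)
    (hpy : p ^ k • y ∈ signedLocalPointsOfEmb κ ι W ε n) : y ∈ signedLocalPointsOfEmb κ ι W ε n := by
  induction k generalizing y with
  | zero => rwa [pow_zero, one_smul] at hpy
  | succ k ih =>
    refine ih hy (mem_signedLocalPointsOfEmb_of_nsmul_mem W κ ι hnt ε n
      (AddSubgroup.nsmul_mem _ hy _) ?_)
    rwa [smul_smul, ← pow_succ']

/-- **The decomposition group acts on `E(K_n·K_v)` through a CYCLIC group**: there is `g ∈ Γ_{K_v}` such that every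
`σ ∈ Γ_{K_v}` acts on `E(K_n·K_v)` as a power `g^j` (the image of `Γ_{K_v}` in the finite cyclic group `Γ_K / Gal(K̄/K_n)`
is cyclic: `exists_generator_mod_layerSubgroup`; powers reduced modulo the finite index of `Gal(K̄_v/K_n·K_v)`).
[cite: Washington1997, §13.1] [cite: GreenbergLNM1716, §3 p. 87] -/
theorem exists_forall_smul_eq_pow_smul (n : ℕ) :
    ∃ g : Field.absoluteGaloisGroup E, ∀ σ : Field.absoluteGaloisGroup E, ∃ j : ℕ,
      ∀ Q ∈ localLayerPointsOfEmb κ ι W n, σ • Q = (g ^ j) • Q := by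
  obtain ⟨d₀, hd₀, hgen⟩ :=
    FineSelmerControl.exists_generator_mod_layerSubgroup κ (resGalOfEmb ι).toMonoidHom.range n
  obtain ⟨g, rfl⟩ := MonoidHom.mem_range.1 hd₀
  refine ⟨g, fun σ ↦ ?_⟩
  obtain ⟨z, hz⟩ := hgen (resGalOfEmb ι σ) ⟨σ, rfl⟩
  have hh : (g ^ z)⁻¹ * σ ∈ localLayerSubgroupOfEmb κ ι n := by
    rw [localLayerSubgroupOfEmb, mem_localSubgroupOfEmb_iff, map_mul, map_inv, map_zpow]
    exact hz
  haveI : (localLayerSubgroupOfEmb κ ι n).Normal := by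
    unfold localLayerSubgroupOfEmb localSubgroupOfEmb; infer_instance
  set Nx : ℕ := (localLayerSubgroupOfEmb κ ι n).index with hNx
  have hNx0 : Nx ≠ 0 := Subgroup.FiniteIndex.index_ne_zero
  have hgN : g ^ Nx ∈ localLayerSubgroupOfEmb κ ι n := Subgroup.pow_index_mem _ g
  have hfixN : ∀ Q ∈ localLayerPointsOfEmb κ ι W n, ∀ w : ℤ, ((g ^ (Nx : ℤ)) ^ w) • Q = Q := fun Q hQ w ↦
    FineSelmerControl.zpow_smul_eq_self_of_smul_eq_self
      (by rw [zpow_natCast]; exact (mem_localLayerPointsOfEmb_iff κ ι W n Q).1 hQ _ hgN) w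
  have hmod : (0 : ℤ) ≤ z % Nx := Int.emod_nonneg _ (by exact_mod_cast hNx0)
  refine ⟨(z % Nx).toNat, fun Q hQ ↦ ?_⟩
  have hfix : ((g ^ z)⁻¹ * σ) • Q = Q := (mem_localLayerPointsOfEmb_iff κ ι W n Q).1 hQ _ hh
  have hz' : g ^ z = (g ^ (Nx : ℤ)) ^ (z / Nx) * g ^ (z % Nx) := by
    conv_lhs => rw [← Int.mul_ediv_add_emod z Nx]
    rw [zpow_add, zpow_mul]
  have hQ' : g ^ (z % (Nx : ℤ)) • Q ∈ localLayerPointsOfEmb κ ι W n := smul_mem_localLayerPointsOfEmb κ ι W n _ hQ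
  calc σ • Q = (g ^ z * ((g ^ z)⁻¹ * σ)) • Q := by rw [mul_inv_cancel_left]
    _ = g ^ z • Q := by rw [mul_smul, hfix]
    _ = ((g ^ (Nx : ℤ)) ^ (z / Nx) * g ^ (z % Nx)) • Q := by rw [hz']
    _ = g ^ (z % (Nx : ℤ)) • Q := by rw [mul_smul, hfixN _ hQ']
    _ = g ^ ((z % (Nx : ℤ)).toNat) • Q := by rw [← zpow_natCast, Int.toNat_of_nonneg hmod]

/-- **MOD-`p` CRITERION from monogenicity** (the `k = 1` case of (LIFT) at layer `n`). Let `M = E(K_∞·K_v)` have no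
`p`-torsion (NT), let `g ∈ Γ_{K_v}` act on `E(K_n·K_v)` as a generator (`hgen`, cf. `exists_forall_smul_eq_pow_smul`), let
`E^ε(K_n·K_v)/p` be MONOGENIC over `ℤ[Γ_{K_v}]` — some `d ∈ E^ε(K_n·K_v)` whose Galois orbit generates `E^ε(K_n·K_v)` modulo
`p·E^ε(K_n·K_v)` (CYC; Kobayashi Prop. 8.12 i): `E^±` is generated by the conjugates of the Honda point) — and let `E(K_v)`
carry a point `m₀ ∉ p·E(K_v)` (LEV0). THEN every `x ∈ E^ε(K_n·K_v)` with `σx − x ∈ p·M` for all `σ ∈ Γ_{K_v}` lies in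
`p·M + E(K_v)`. Proof: in `V = E^ε_n` modulo `N = pV`, `D = g − 1` is nilpotent on `d` (`pow_prime_pow_sub_one_apply_mem`,
`g^{p^n}` fixes `E(K_n·K_v)`), `V = ℤ[D]d + N` (`closure_range_pow_smul_le`), so the socle lemma gives `ker D ⊆ ℤs + N`; the
fixed point `m₀` pins `s ≡ w·m₀`; `x` is `D`-fixed modulo `N` by saturation. [cite: Kobayashi2003, Prop. 8.12 (pp. 17–18)]
[cite: BDKim2013, proof of Cor. 3.15 (p. 199)] -/
theorem modP_of_cyclic (hnt : ∀ P ∈ localTowerPointsOfEmb κ ι W, p • P = 0 → P = 0) (ε : ℤˣ) (n : ℕ)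
    (g : Field.absoluteGaloisGroup E)
    (hgen : ∀ σ : Field.absoluteGaloisGroup E, ∃ j : ℕ, ∀ Q ∈ localLayerPointsOfEmb κ ι W n, σ • Q = (g ^ j) • Q)
    (hcyc : ∃ d ∈ signedLocalPointsOfEmb κ ι W ε n, ∀ x ∈ signedLocalPointsOfEmb κ ι W ε n,
      ∃ B ∈ AddSubgroup.closure (Set.range fun σ : Field.absoluteGaloisGroup E ↦ σ • d),
        ∃ b ∈ signedLocalPointsOfEmb κ ι W ε n, x = B + p • b)
    (hlev : ∃ m₀ ∈ localLayerPointsOfEmb κ ι W 0, ∀ b ∈ localLayerPointsOfEmb κ ι W 0, m₀ ≠ p • b) :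
    ∀ x ∈ signedLocalPointsOfEmb κ ι W ε n,
      (∀ σ : Field.absoluteGaloisGroup E, ∃ w ∈ localTowerPointsOfEmb κ ι W, σ • x - x = p • w) →
      ∃ R ∈ localTowerPointsOfEmb κ ι W, x - p • R ∈ localLayerPointsOfEmb κ ι W 0 := by
  intro x hx hinv
  -- notation and basic inclusions
  have hAMn : signedLocalPointsOfEmb κ ι W ε n ≤ localLayerPointsOfEmb κ ι W n := signedLocalPointsOfEmb_le κ ι W ε n
  have hAM : signedLocalPointsOfEmb κ ι W ε n ≤ localTowerPointsOfEmb κ ι W :=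
    hAMn.trans (localLayerPointsOfEmb_le_localTowerPointsOfEmb κ ι W n)
  have h0A : localLayerPointsOfEmb κ ι W 0 ≤ signedLocalPointsOfEmb κ ι W ε n :=
    localLayerPointsOfEmb_zero_le_signedLocalPointsOfEmb κ ι W ε n
  have hstab : ∀ (σ : Field.absoluteGaloisGroup E), ∀ a ∈ signedLocalPointsOfEmb κ ι W ε n,
      σ • a ∈ signedLocalPointsOfEmb κ ι W ε n := by
    intro σ a ha
    rw [signedLocalPointsOfEmb_eq_towerSigned] at ha ⊢
    exact smul_mem_towerSignedLocalPointsOfEmb κ.layerSubgroup ι W ε n σ ha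
  have h0fix : ∀ m ∈ localLayerPointsOfEmb κ ι W 0, ∀ σ : Field.absoluteGaloisGroup E, σ • m = m :=
    fun m hm σ ↦ (mem_localLayerPointsOfEmb_zero_iff κ ι W m).1 hm σ
  -- the abelian group `V = E^ε_n`, its subgroup `N = pV`, the endomorphism `φ = g`, `D = φ - 1`
  set V := ↥(signedLocalPointsOfEmb κ ι W ε n) with hV
  let N : AddSubgroup V := (nsmulAddMonoidHom (α := V) p).range
  have hNmem : ∀ v : V, v ∈ N ↔ ∃ b : V, p • b = v := fun v ↦ by
    simp only [N, AddMonoidHom.mem_range, nsmulAddMonoidHom_apply]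
  let φ : AddMonoid.End V := AddMonoidHom.mk' (fun a ↦ ⟨g • (a : localPoints W E), hstab g a a.2⟩)
    (fun a b ↦ by ext; exact smul_add g (a : localPoints W E) b)
  have hφ : ∀ a : V, ((φ a : V) : localPoints W E) = g • (a : localPoints W E) := fun a ↦ rfl
  have hφpow : ∀ (k : ℕ) (a : V), (((φ ^ k) a : V) : localPoints W E) = g ^ k • (a : localPoints W E) := by
    intro k
    induction k with
    | zero => intro a; rw [pow_zero, AddMonoid.End.one_apply, pow_zero, one_smul]
    | succ k ih => intro a; rw [pow_succ, addMonoidEnd_mul_apply, ih, hφ, smul_smul, ← pow_succ]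
  set D : AddMonoid.End V := φ - 1 with hDdef
  have hD : ∀ a : V, ((D a : V) : localPoints W E) = g • (a : localPoints W E) - a := fun a ↦ by
    rw [hDdef, addMonoidEnd_sub_apply, AddMonoid.End.one_apply, AddSubgroup.coe_sub, hφ]
  -- (i) `pV ⊆ N`, (ii) `D N ⊆ N`
  have hpN : ∀ v : V, (p : ℤ) • v ∈ N := fun v ↦ (hNmem _).2 ⟨v, by rw [natCast_zsmul]⟩
  have hDN : ∀ v ∈ N, D v ∈ N := by
    intro v hv
    obtain ⟨b, rfl⟩ := (hNmem v).1 hv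
    exact (hNmem _).2 ⟨D b, by rw [map_nsmul]⟩
  -- the generator
  obtain ⟨d, hd, hgenA⟩ := hcyc
  set d' : V := ⟨d, hd⟩ with hd'
  -- (iii) nilpotency: `g^{p^n}` fixes `E(K_n·K_v)`
  haveI : (localLayerSubgroupOfEmb κ ι n).Normal := by
    unfold localLayerSubgroupOfEmb localSubgroupOfEmb; infer_instance
  have hgpn : g ^ p ^ n ∈ localLayerSubgroupOfEmb κ ι n := by
    obtain ⟨c, hc⟩ := index_localLayerSubgroupOfEmb_dvd κ ι n
    rw [hc, pow_mul]
    exact Subgroup.pow_mem _ (Subgroup.pow_index_mem _ g) c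
  have hnil : ∃ r : ℕ, (D ^ r) d' ∈ N := by
    refine ⟨p ^ n, ?_⟩
    rw [hDdef]
    refine pow_prime_pow_sub_one_apply_mem N d' p hpN φ n ?_
    apply Subtype.ext
    rw [hφpow]
    exact (mem_localLayerPointsOfEmb_iff κ ι W n d).1 (hAMn hd) _ hgpn
  -- (iv) span: the orbit of `d` lies in the `D`-span of `d'`
  set C : AddSubgroup V := AddSubgroup.closure (Set.range fun j : ℕ ↦ (D ^ j) d') with hC
  have horbit : AddSubgroup.closure (Set.range fun σ : Field.absoluteGaloisGroup E ↦ σ • d) ≤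
      C.map (signedLocalPointsOfEmb κ ι W ε n).subtype := by
    refine (AddSubgroup.closure_le _).2 ?_
    rintro _ ⟨σ, rfl⟩
    obtain ⟨j, hj⟩ := hgen σ
    refine ⟨(φ ^ j) d', ?_, ?_⟩
    · have := closure_range_pow_smul_le d' φ (AddSubgroup.subset_closure ⟨j, rfl⟩)
      rw [← hDdef] at this
      exact this
    · rw [AddSubgroup.coe_subtype, hφpow, hd']
      exact (hj d (hAMn hd)).symm
  have hspan : ∀ v : V, ∃ nn ∈ N, v - nn ∈ C := by
    intro v
    obtain ⟨B, hB, b, hb, hvB⟩ := hgenA v v.2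
    obtain ⟨v₀, hv₀C, hv₀B⟩ := horbit hB
    refine ⟨p • ⟨b, hb⟩, (hNmem _).2 ⟨⟨b, hb⟩, rfl⟩, ?_⟩
    have e : v - p • ⟨b, hb⟩ = v₀ := by
      apply Subtype.ext
      rw [AddSubgroup.coe_sub, AddSubgroupClass.coe_nsmul, hvB]
      change B + p • b - p • b = ((signedLocalPointsOfEmb κ ι W ε n).subtype v₀ : localPoints W E)
      rw [hv₀B, add_sub_cancel_right]
    rw [e]; exact hv₀C
  -- (v) the socle lemma
  obtain ⟨s, hs⟩ := exists_socle_generator N D d' p hpN hDN hnil hspan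
  -- (vi) the bottom point `m₀` pins the socle generator
  obtain ⟨m₀, hm₀, hm₀p⟩ := hlev
  set m₀' : V := ⟨m₀, h0A hm₀⟩ with hm₀'
  have hDm₀ : D m₀' ∈ N := by
    have : D m₀' = 0 := by
      apply Subtype.ext
      rw [hD, hm₀', h0fix m₀ hm₀ g, sub_self, ZeroMemClass.coe_zero]
    rw [this]; exact N.zero_mem
  obtain ⟨c₀, hc₀⟩ := hs m₀' hDm₀
  have hc₀p : ¬ (p : ℤ) ∣ c₀ := by
    rintro ⟨c', hc'⟩
    -- then `m₀' ∈ N`, i.e. `m₀ = p • b` with `b ∈ E^ε_n`, hence `b ∈ E(K_v)`: contradiction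
    have hmN : m₀' ∈ N := by
      have := N.add_mem hc₀ (N.zsmul_mem (hpN s) c')
      rwa [hc', mul_comm, mul_smul, sub_add_cancel] at this
    obtain ⟨b, hb⟩ := (hNmem _).1 hmN
    have hbP : p • (b : localPoints W E) = m₀ := by
      have := congrArg Subtype.val hb
      rwa [AddSubgroupClass.coe_nsmul] at this
    have hb0 : (b : localPoints W E) ∈ localLayerPointsOfEmb κ ι W 0 :=
      mem_localLayerPointsOfEmb_of_nsmul_mem W κ ι hnt 0 (hAM b.2) (by rw [hbP]; exact hm₀)
    exact hm₀p b hb0 hbP.symm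
  obtain ⟨u, w, huw⟩ := (Prime.coprime_iff_not_dvd (Nat.prime_iff_prime_int.mp (Fact.out : p.Prime))).mpr hc₀p
  have hsm₀ : s - w • m₀' ∈ N := by
    have e : s - w • m₀' = u • ((p : ℤ) • s) - w • (m₀' - c₀ • s) := by
      have : s = u • ((p : ℤ) • s) + w • (c₀ • s) := by
        rw [← mul_smul, ← mul_smul, ← add_smul, huw, one_smul]
      conv_lhs => rw [this]
      rw [smul_sub]; abel
    rw [e]; exact N.sub_mem (N.zsmul_mem (hpN s) u) (N.zsmul_mem hc₀ w)
  -- (vii) the class `x`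
  obtain ⟨wx, hwx, hgx⟩ := hinv g
  have hwxA : wx ∈ signedLocalPointsOfEmb κ ι W ε n :=
    mem_signedLocalPointsOfEmb_of_nsmul_mem W κ ι hnt ε n hwx (by rw [← hgx]; exact sub_mem (hstab g x hx) hx)
  set x' : V := ⟨x, hx⟩ with hx'
  have hDx : D x' ∈ N := by
    refine (hNmem _).2 ⟨⟨wx, hwxA⟩, Subtype.ext ?_⟩
    rw [AddSubgroupClass.coe_nsmul, hD]
    exact hgx.symm
  obtain ⟨c, hc⟩ := hs x' hDx
  have hxm : x' - (c * w) • m₀' ∈ N := by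
    have e : x' - (c * w) • m₀' = (x' - c • s) + c • (s - w • m₀') := by rw [mul_smul, smul_sub]; abel
    rw [e]; exact N.add_mem hc (N.zsmul_mem hsm₀ c)
  obtain ⟨b, hb⟩ := (hNmem _).1 hxm
  refine ⟨b, hAM b.2, ?_⟩
  have e : x - p • (b : localPoints W E) = (c * w) • m₀ := by
    have := congrArg Subtype.val hb
    rw [AddSubgroupClass.coe_nsmul, AddSubgroup.coe_sub, AddSubgroupClass.coe_zsmul] at this
    rw [this]; simp [hx', hm₀']
  rw [e]
  exact AddSubgroup.zsmul_mem _ hm₀ _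

end ModP

end Summit.BirchSwinnertonDyer.BirchSwinnertonDyer.Theorems.SignedEC

end
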